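import Literature.AlgebraicGeometry.Motives.JacobianGaloisCoverNormImage
import Literature.AlgebraicGeometry.Motives.AbelianVarietyTetrahedralIdempotentRelations
import Literature.AlgebraicGeometry.Motives.AbelianVarietySymmetricGroupIdempotentRelations
import HarnessLib

/-!
# Tetrahedral, octahedral and icosahedral group actions on a curve: the Kani–Rosen relations WITH the quotient Jacobians —
# `J_X × J_{X/A₄}³ ∼ J_{X/V} × J_{X/⟨σ⟩}³`, `J_X × J_{X/V}² ∼ J_{X/⟨τ⟩}³`, `J_X × J_{X/S₄}² ∼ J_{X/C₂} × J_{X/C₃} × J_{X/C₄}`,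
# `J_X × J_{X/A₅}² ∼ J_{X/C₂} × J_{X/C₃} × J_{X/C₅}`, and the genus relations (Kani–Rosen 1989 Thm. B; Lange–Rodríguez 2022 §5.5;
# Korchmáros–Lia–Timpanella 2021 Thm. 10.1)

Layer `Literature/AlgebraicGeometry/Motives`, namespace `Literature.AlgebraicGeometry.Motives.Jacobian`.  THEOREMS ONLY: the `A₄`-, `S₄`- and
`A₅`-type isogeny relations of `Motives/AbelianVarietyTetrahedralIdempotentRelations` and `Motives/AbelianVarietySymmetricGroupIdempotentRelations`
(stated there for an abelian variety `X` with a `G`-action and the IMAGES `B_H = Im N_H = ε_H(X)`; «the quotient-curve reading `ε_H(J̃) ∼ J_{C̃/H}`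
is not asserted here») are transported to the Jacobians of the quotient curves along ★ `Motives/JacobianGaloisCoverNormImage`
(`Jacobian.isIsogenous_image_sum_pushforward_act`: `Im(Σ_{h ∈ H} h_*) ∼ J_{X/H}`), in the def-free currency of ★ `Motives/JacobianGaloisCoverNorm`
(`t` pinned by `Nm_q ≫ t = Σ_{h ∈ H} h_*`); sequel of ★ `Motives/JacobianDihedralQuotientIsogeny` (dihedral and Klein four-groups).  No definition,
no named fact, no instance, no `sorry`; nothing of the prequels is restated.

THE PRINT.  H. Lange, R. E. Rodríguez, *Decomposition of Jacobians by Prym Varieties* (2022), §5.5 (the alternating group `A₄`): Prop. 5.5.3,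
Cor. 5.5.4, Thm. 5.5.5 «`J̃ ∼ J × P(h_K) × P(ε)`, `P(ε) ∼ P(h_σ)³`», Cor. 5.5.2 (genera).  G. Korchmáros, S. Lia, M. Timpanella (2021) §10
Thm. 10.1 (32)–(33) (Theorem B for `S₄`, `A₅`, `S₅` through their partitions into maximal cyclic subgroups).  E. Kani, M. Rosen (1989) Thm. B.

WHAT IS PROVED (perfect ground field for the isogenies; `act : G →* Aut X`, quotients `q_H : X → X/H` with `IsSepQuotient` for the listed `H`,
their Jacobians and pinned pull-backs, a rational point `P₀` of `X`):
* `G ⊇ V`, `|G| = 3|V|`, `V` of exponent two, elements outside `V` of order three, `σ ∉ V` (`A₄`-type): **`isIsogenous_tetrahedral_quotientJacobian`**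
  `J_X × J_{X/G}³ ∼ J_{X/V} × J_{X/⟨σ⟩}³` (★ `AbelianVariety.isIsogenous_tetrahedral`), `dim_tetrahedral_quotientJacobian`; with `|V| = 4`, `τ ∈ V ∖ 1`:
  **`isIsogenous_tetrahedral_involution_quotientJacobian`** `J_X × J_{X/V}² ∼ J_{X/⟨τ⟩}³` (★ `isIsogenous_tetrahedral_involution`),
  `dim_tetrahedral_involution_quotientJacobian`;
* `S₄ = Equiv.Perm (Fin 4)`: **`isIsogenous_symFour_quotientJacobian`** `J_X × J_{X/S₄}² ∼ J_{X/⟨(01)⟩} × J_{X/⟨(012)⟩} × J_{X/⟨(0123)⟩}`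
  (★ `isIsogenous_symFour`), `dim_symFour_quotientJacobian`;
* `A₅ = alternatingGroup (Fin 5)`: **`isIsogenous_altFive_quotientJacobian`** `J_X × J_{X/A₅}² ∼ J_{X/⟨(01)(23)⟩} × J_{X/⟨(012)⟩} × J_{X/⟨(01234)⟩}`
  (★ `isIsogenous_altFive`), `dim_altFive_quotientJacobian`.

Scope (stated, not hidden). As in the prequels: pull-backs are binders with their pins; Jacobians and quotient curves are hypotheses; perfect field for
the isogenies (Hom-count criterion); genus `= dim J` not restated.  The TORUS-carrier files under `Geometry/Kaehler/` are a different carrier (RULING 29 bis).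
Cell `hodgecm-mathlib` (D-0151), PROOF lane, count-neutral (`--supports stmt-HodgeConjecture-24832`); HC_CM is proved only modulo the 7 printed
citations until rung 0 closes.

## References
* [LangeRodriguez2022] H. Lange, R. E. Rodríguez, LNM 2310 (2022): §5.5.1–5.5.2 (Prop. 5.5.3, Cor. 5.5.2, Cor. 5.5.4, Thm. 5.5.5); §3.5.1 Prop. 3.5.1 (p. 65).
* [KaniRosen1989] E. Kani, M. Rosen, Math. Ann. 284 (1989) 307–327, Thm. B.
* [KorchmarosLiaTimpanella2021] G. Korchmáros, S. Lia, M. Timpanella (2021), §10 Thm. 10.1 (32)–(33).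
* [Paulhus2008] J. Paulhus, Acta Arith. 132 (2008), §3 (3) and Fact 2 (p. 234).
-/

set_option autoImplicit false

noncomputable section

universe u

open CategoryTheory CategoryTheory.Limits AlgebraicGeometry Equiv

namespace Literature.AlgebraicGeometry.Motives

namespace Jacobian

/-! ## §0 Plumbing: the norm sums as sums in `End J_X` (stated once over an ABSTRACT index subgroup, so that no concrete
`Fintype` instance is ever unfolded by the kernel) -/

section Plumbing

variable {k : Type u} [Field k] {X : SchemeOver k} (𝒥X : Jacobian X) {G : Type} [Group G] (act : G →* Aut X)

/-- `End.of (Σ_{h ∈ H} h_*) = Σ_{h ∈ H} ρ h` for any `ρ` agreeing with `g ↦ g_*` (bookkeeping between the `Hom`- and the `End`-valued sums).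
[cite: KaniRosen1989, Thm. B] -/
private theorem end_of_sum_subgroup (ρ : G →* End 𝒥X.J) (hρ : ∀ g, ρ g = 𝒥X.pushforward 𝒥X (act g).hom)
    (H : Subgroup G) [Fintype H] :
    End.of (∑ h : H, 𝒥X.pushforward 𝒥X (act h).hom) = ∑ h : H, ρ h := by
  simp only [hρ]
  rfl

/-- `End.of (Σ_{g ∈ G} g_*) = Σ_g ρ g`. [cite: KaniRosen1989, Thm. B] -/
private theorem end_of_sum_univ [Fintype G] (ρ : G →* End 𝒥X.J) (hρ : ∀ g, ρ g = 𝒥X.pushforward 𝒥X (act g).hom) :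
    End.of (∑ g : G, 𝒥X.pushforward 𝒥X (act g).hom) = ∑ g : G, ρ g := by
  simp only [hρ]
  rfl

end Plumbing

/-! ## §1 Tetrahedral (`A₄`-type) actions -/

section Tetrahedral

variable {k : Type u} [Field k] [PerfectField k] {X : SchemeOver k} (𝒥X : Jacobian X)
  {G : Type} [Group G] [Fintype G] (act : G →* Aut X) {V : Subgroup G} [Fintype V] {σ τ : G}

/-- **`J_X × J_{X/G}³ ∼ J_{X/V} × J_{X/⟨σ⟩}³` for an `A₄`-type action** (`|G| = 3|V|`, `V` of exponent `2`, every element outside `V` of order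
`3`, `σ ∉ V`; «`J̃ ∼ J × P(h_K) × P(ε)`, `P(ε) ∼ P(h_σ)³`» read with the quotient Jacobians) — ★ `AbelianVariety.isIsogenous_tetrahedral`
transported along ★ `Jacobian.isIsogenous_image_sum_pushforward_act`. [cite: LangeRodriguez2022, §5.5.2 Prop. 5.5.3, Cor. 5.5.4 and Thm. 5.5.5 (PDF pp. 130–131)]
[cite: KaniRosen1989, Thm. B] -/
theorem isIsogenous_tetrahedral_quotientJacobian [Fintype (Subgroup.zpowers σ)] (hG : Fintype.card G = 3 * Fintype.card V)
    (hV2 : ∀ v ∈ V, v ^ 2 = 1) (hout : ∀ g : G, g ∉ V → g ^ 3 = 1) (hσ : σ ∉ V)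
    {YG : SchemeOver k} (𝒥G : Jacobian YG) (qG : X ⟶ YG)
    (hqG : IsSepQuotient (fun g : G => act g) qG) (tG : 𝒥G.J ⟶ 𝒥X.J)
    (htG : 𝒥X.pushforward 𝒥G qG ≫ tG = ∑ g : G, 𝒥X.pushforward 𝒥X (act g).hom)
    {YV : SchemeOver k} (𝒥V : Jacobian YV) (qV : X ⟶ YV)
    (hqV : IsSepQuotient (fun h : V => act h) qV) (tV : 𝒥V.J ⟶ 𝒥X.J)
    (htV : 𝒥X.pushforward 𝒥V qV ≫ tV = ∑ h : V, 𝒥X.pushforward 𝒥X (act h).hom)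
    {YS : SchemeOver k} (𝒥S : Jacobian YS) (qS : X ⟶ YS)
    (hqS : IsSepQuotient (fun h : Subgroup.zpowers σ => act h) qS) (tS : 𝒥S.J ⟶ 𝒥X.J)
    (htS : 𝒥X.pushforward 𝒥S qS ≫ tS = ∑ h : Subgroup.zpowers σ, 𝒥X.pushforward 𝒥X (act h).hom)
    (P₀ : AlgPoints X k) :
    AbelianVariety.IsIsogenous (𝒥X.J ⊞ (𝒥G.J ⊞ (𝒥G.J ⊞ 𝒥G.J))) (𝒥V.J ⊞ (𝒥S.J ⊞ (𝒥S.J ⊞ 𝒥S.J))) := by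
  let ρ : G →* End 𝒥X.J :=
    { toFun := fun g => 𝒥X.pushforward 𝒥X (act g).hom
      map_one' := by
        change 𝒥X.pushforward 𝒥X (act 1).hom = 𝟙 𝒥X.J
        rw [map_one]
        exact 𝒥X.pushforward_id
      map_mul' := fun g g' => by
        change 𝒥X.pushforward 𝒥X (act (g * g')).hom =
          𝒥X.pushforward 𝒥X (act g').hom ≫ 𝒥X.pushforward 𝒥X (act g).hom
        rw [map_mul, ← pushforward_comp]
        rfl }
  have hρ : ∀ g, ρ g = 𝒥X.pushforward 𝒥X (act g).hom := fun _ => rfl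
  have hN := 𝒥X.end_of_sum_univ act ρ hρ
  have hNV := 𝒥X.end_of_sum_subgroup act ρ hρ (V)
  have hNS := 𝒥X.end_of_sum_subgroup act ρ hρ (Subgroup.zpowers σ)
  have h := AbelianVariety.isIsogenous_tetrahedral ρ hG hV2 hout hσ hN hNV hNS
  have eG := 𝒥X.isIsogenous_image_sum_pushforward_act 𝒥G (fun g : G => act g) qG hqG P₀ tG htG
  have eV := 𝒥X.isIsogenous_image_sum_pushforward_act_symm 𝒥V (fun h : V => act h) qV hqV P₀ tV htV
  have eS := 𝒥X.isIsogenous_image_sum_pushforward_act_symm 𝒥S (fun h : Subgroup.zpowers σ => act h) qS hqS P₀ tS htS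
  exact (((AbelianVariety.IsIsogenous.refl 𝒥X.J).biprod (eG.biprod (eG.biprod eG))).trans h).trans
    (eV.biprod (eS.biprod (eS.biprod eS)))

/-- **The `A₄` genus relation `g_X + 3 g_{X/G} = g_{X/V} + 3 g_{X/⟨σ⟩}`** on the dimensions of the Jacobians.
[cite: LangeRodriguez2022, §5.5.1 Cor. 5.5.2 (PDF p. 129)] [cite: KaniRosen1989, Thm. B] -/
theorem dim_tetrahedral_quotientJacobian [Fintype (Subgroup.zpowers σ)] (hG : Fintype.card G = 3 * Fintype.card V)
    (hV2 : ∀ v ∈ V, v ^ 2 = 1) (hout : ∀ g : G, g ∉ V → g ^ 3 = 1) (hσ : σ ∉ V)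
    {YG : SchemeOver k} (𝒥G : Jacobian YG) (qG : X ⟶ YG)
    (hqG : IsSepQuotient (fun g : G => act g) qG) (tG : 𝒥G.J ⟶ 𝒥X.J)
    (htG : 𝒥X.pushforward 𝒥G qG ≫ tG = ∑ g : G, 𝒥X.pushforward 𝒥X (act g).hom)
    {YV : SchemeOver k} (𝒥V : Jacobian YV) (qV : X ⟶ YV)
    (hqV : IsSepQuotient (fun h : V => act h) qV) (tV : 𝒥V.J ⟶ 𝒥X.J)
    (htV : 𝒥X.pushforward 𝒥V qV ≫ tV = ∑ h : V, 𝒥X.pushforward 𝒥X (act h).hom)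
    {YS : SchemeOver k} (𝒥S : Jacobian YS) (qS : X ⟶ YS)
    (hqS : IsSepQuotient (fun h : Subgroup.zpowers σ => act h) qS) (tS : 𝒥S.J ⟶ 𝒥X.J)
    (htS : 𝒥X.pushforward 𝒥S qS ≫ tS = ∑ h : Subgroup.zpowers σ, 𝒥X.pushforward 𝒥X (act h).hom)
    (P₀ : AlgPoints X k) :
    𝒥X.J.dim + 3 * 𝒥G.J.dim = 𝒥V.J.dim + 3 * 𝒥S.J.dim := by
  have e := (𝒥X.isIsogenous_tetrahedral_quotientJacobian act hG hV2 hout hσ 𝒥G qG hqG tG htG 𝒥V qV hqV tV htV 𝒥S qS hqS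
    tS htS P₀).dim_eq
  simp only [AbelianVariety.dim_biprod] at e
  omega

/-- **`J_X × J_{X/V}² ∼ J_{X/⟨τ⟩}³`** (`|V| = 4`, `τ ∈ V ∖ {1}`, `σ ∉ V`; the Klein relation of `V` with its three involutions conjugate under `σ`;
«`A_{W_2} = P(ε) ∼ k_τ^* P(ℓ_τ)³`») — ★ `AbelianVariety.isIsogenous_tetrahedral_involution` transported to the quotient Jacobians.
[cite: LangeRodriguez2022, §5.5.2 Prop. 5.5.3 (PDF p. 130)] [cite: Paulhus2008, §3 (3) and Fact 2 (p. 234)] [cite: KaniRosen1989, Thm. B] -/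
theorem isIsogenous_tetrahedral_involution_quotientJacobian [Fintype (Subgroup.zpowers τ)] (hV : Fintype.card V = 4)
    (hV2 : ∀ v ∈ V, v ^ 2 = 1) (hout : ∀ g : G, g ∉ V → g ^ 3 = 1) (hσ : σ ∉ V) (hτV : τ ∈ V) (hτ1 : τ ≠ 1)
    {YV : SchemeOver k} (𝒥V : Jacobian YV) (qV : X ⟶ YV)
    (hqV : IsSepQuotient (fun h : V => act h) qV) (tV : 𝒥V.J ⟶ 𝒥X.J)
    (htV : 𝒥X.pushforward 𝒥V qV ≫ tV = ∑ h : V, 𝒥X.pushforward 𝒥X (act h).hom)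
    {YT : SchemeOver k} (𝒥T : Jacobian YT) (qT : X ⟶ YT)
    (hqT : IsSepQuotient (fun h : Subgroup.zpowers τ => act h) qT) (tT : 𝒥T.J ⟶ 𝒥X.J)
    (htT : 𝒥X.pushforward 𝒥T qT ≫ tT = ∑ h : Subgroup.zpowers τ, 𝒥X.pushforward 𝒥X (act h).hom)
    (P₀ : AlgPoints X k) :
    AbelianVariety.IsIsogenous (𝒥X.J ⊞ (𝒥V.J ⊞ 𝒥V.J)) (𝒥T.J ⊞ (𝒥T.J ⊞ 𝒥T.J)) := by
  let ρ : G →* End 𝒥X.J :=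
    { toFun := fun g => 𝒥X.pushforward 𝒥X (act g).hom
      map_one' := by
        change 𝒥X.pushforward 𝒥X (act 1).hom = 𝟙 𝒥X.J
        rw [map_one]
        exact 𝒥X.pushforward_id
      map_mul' := fun g g' => by
        change 𝒥X.pushforward 𝒥X (act (g * g')).hom =
          𝒥X.pushforward 𝒥X (act g').hom ≫ 𝒥X.pushforward 𝒥X (act g).hom
        rw [map_mul, ← pushforward_comp]
        rfl }
  have hρ : ∀ g, ρ g = 𝒥X.pushforward 𝒥X (act g).hom := fun _ => rfl
  have hNV := 𝒥X.end_of_sum_subgroup act ρ hρ (V)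
  have hNT := 𝒥X.end_of_sum_subgroup act ρ hρ (Subgroup.zpowers τ)
  have h := AbelianVariety.isIsogenous_tetrahedral_involution ρ hV hV2 hout hσ hτV hτ1 hNV hNT
  have eV := 𝒥X.isIsogenous_image_sum_pushforward_act 𝒥V (fun h : V => act h) qV hqV P₀ tV htV
  have eT := 𝒥X.isIsogenous_image_sum_pushforward_act_symm 𝒥T (fun h : Subgroup.zpowers τ => act h) qT hqT P₀ tT htT
  exact (((AbelianVariety.IsIsogenous.refl 𝒥X.J).biprod (eV.biprod eV)).trans h).trans (eT.biprod (eT.biprod eT))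

/-- **Genus relation `g_X + 2 g_{X/V} = 3 g_{X/⟨τ⟩}`** on the dimensions of the Jacobians. [cite: LangeRodriguez2022, §5.5.1 Cor. 5.5.2 (PDF p. 129) and §5.5.2 Prop. 5.5.3]
[cite: KaniRosen1989, Thm. B] -/
theorem dim_tetrahedral_involution_quotientJacobian [Fintype (Subgroup.zpowers τ)] (hV : Fintype.card V = 4)
    (hV2 : ∀ v ∈ V, v ^ 2 = 1) (hout : ∀ g : G, g ∉ V → g ^ 3 = 1) (hσ : σ ∉ V) (hτV : τ ∈ V) (hτ1 : τ ≠ 1)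
    {YV : SchemeOver k} (𝒥V : Jacobian YV) (qV : X ⟶ YV)
    (hqV : IsSepQuotient (fun h : V => act h) qV) (tV : 𝒥V.J ⟶ 𝒥X.J)
    (htV : 𝒥X.pushforward 𝒥V qV ≫ tV = ∑ h : V, 𝒥X.pushforward 𝒥X (act h).hom)
    {YT : SchemeOver k} (𝒥T : Jacobian YT) (qT : X ⟶ YT)
    (hqT : IsSepQuotient (fun h : Subgroup.zpowers τ => act h) qT) (tT : 𝒥T.J ⟶ 𝒥X.J)
    (htT : 𝒥X.pushforward 𝒥T qT ≫ tT = ∑ h : Subgroup.zpowers τ, 𝒥X.pushforward 𝒥X (act h).hom)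
    (P₀ : AlgPoints X k) :
    𝒥X.J.dim + 2 * 𝒥V.J.dim = 3 * 𝒥T.J.dim := by
  have e := (𝒥X.isIsogenous_tetrahedral_involution_quotientJacobian act hV hV2 hout hσ hτV hτ1 𝒥V qV hqV tV htV 𝒥T qT hqT
    tT htT P₀).dim_eq
  simp only [AbelianVariety.dim_biprod] at e
  omega

end Tetrahedral

/-! ## §2 The symmetric group `S₄` (octahedral) -/

section SymFour

variable {k : Type u} [Field k] [PerfectField k] {X : SchemeOver k} (𝒥X : Jacobian X) (act : Perm (Fin 4) →* Aut X)

/-- **`J_X × J_{X/S₄}² ∼ J_{X/⟨(01)⟩} × J_{X/⟨(012)⟩} × J_{X/⟨(0123)⟩}`** for an action of `S₄ = Equiv.Perm (Fin 4)` on `X`, quotients by `S₄` and by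
the cyclic subgroups generated by `(01)`, `(012) = swap 0 1 * swap 1 2`, `(0123) = swap 0 1 * swap 1 2 * swap 2 3`, with Jacobians and pinned pull-backs, a
rational point on `X`, perfect ground field — ★ `AbelianVariety.isIsogenous_symFour` transported to the quotient Jacobians.
[cite: KaniRosen1989, Thm. B] [cite: KorchmarosLiaTimpanella2021, §10 Thm. 10.1 (32)–(33)] -/
theorem isIsogenous_symFour_quotientJacobian
    {YG : SchemeOver k} (𝒥G : Jacobian YG) (qG : X ⟶ YG)
    (hqG : IsSepQuotient (fun g : Perm (Fin 4) => act g) qG) (tG : 𝒥G.J ⟶ 𝒥X.J)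
    (htG : 𝒥X.pushforward 𝒥G qG ≫ tG = ∑ g : Perm (Fin 4), 𝒥X.pushforward 𝒥X (act g).hom)
    {Y2 : SchemeOver k} (𝒥2 : Jacobian Y2) (q2 : X ⟶ Y2)
    (hq2 : IsSepQuotient (fun h : Subgroup.zpowers (swap (0 : Fin 4) 1) => act h) q2) (t2 : 𝒥2.J ⟶ 𝒥X.J)
    (ht2 : 𝒥X.pushforward 𝒥2 q2 ≫ t2 = ∑ h : Subgroup.zpowers (swap (0 : Fin 4) 1), 𝒥X.pushforward 𝒥X (act h).hom)
    {Y3 : SchemeOver k} (𝒥3 : Jacobian Y3) (q3 : X ⟶ Y3)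
    (hq3 : IsSepQuotient (fun h : Subgroup.zpowers (swap (0 : Fin 4) 1 * swap 1 2) => act h) q3) (t3 : 𝒥3.J ⟶ 𝒥X.J)
    (ht3 : 𝒥X.pushforward 𝒥3 q3 ≫ t3 = ∑ h : Subgroup.zpowers (swap (0 : Fin 4) 1 * swap 1 2), 𝒥X.pushforward 𝒥X (act h).hom)
    {Y4 : SchemeOver k} (𝒥4 : Jacobian Y4) (q4 : X ⟶ Y4)
    (hq4 : IsSepQuotient (fun h : Subgroup.zpowers (swap (0 : Fin 4) 1 * swap 1 2 * swap 2 3) => act h) q4) (t4 : 𝒥4.J ⟶ 𝒥X.J)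
    (ht4 : 𝒥X.pushforward 𝒥4 q4 ≫ t4 = ∑ h : Subgroup.zpowers (swap (0 : Fin 4) 1 * swap 1 2 * swap 2 3), 𝒥X.pushforward 𝒥X (act h).hom)
    (P₀ : AlgPoints X k) :
    AbelianVariety.IsIsogenous (𝒥X.J ⊞ (𝒥G.J ⊞ 𝒥G.J)) (𝒥2.J ⊞ (𝒥3.J ⊞ 𝒥4.J)) := by
  let ρ : Perm (Fin 4) →* End 𝒥X.J :=
    { toFun := fun g => 𝒥X.pushforward 𝒥X (act g).hom
      map_one' := by
        change 𝒥X.pushforward 𝒥X (act 1).hom = 𝟙 𝒥X.J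
        rw [map_one]
        exact 𝒥X.pushforward_id
      map_mul' := fun g g' => by
        change 𝒥X.pushforward 𝒥X (act (g * g')).hom =
          𝒥X.pushforward 𝒥X (act g').hom ≫ 𝒥X.pushforward 𝒥X (act g).hom
        rw [map_mul, ← pushforward_comp]
        rfl }
  have hρ : ∀ g, ρ g = 𝒥X.pushforward 𝒥X (act g).hom := fun _ => rfl
  have hN₂ := 𝒥X.end_of_sum_subgroup act ρ hρ (Subgroup.zpowers (swap (0 : Fin 4) 1))
  have hN₃ := 𝒥X.end_of_sum_subgroup act ρ hρ (Subgroup.zpowers (swap (0 : Fin 4) 1 * swap 1 2))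
  have hN₄ := 𝒥X.end_of_sum_subgroup act ρ hρ (Subgroup.zpowers (swap (0 : Fin 4) 1 * swap 1 2 * swap 2 3))
  have hNG := 𝒥X.end_of_sum_univ act ρ hρ
  have h := AbelianVariety.isIsogenous_symFour ρ hN₂ hN₃ hN₄ hNG
  -- abstract the three generators (no concrete permutation is left for the kernel to evaluate)
  generalize (swap (0 : Fin 4) 1 * swap 1 2 * swap 2 3 : Perm (Fin 4)) = g₄ at h hq4 ht4
  generalize (swap (0 : Fin 4) 1 * swap 1 2 : Perm (Fin 4)) = g₃ at h hq3 ht3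
  generalize (swap (0 : Fin 4) 1 : Perm (Fin 4)) = g₂ at h hq2 ht2
  haveI : Nonempty (Subgroup.zpowers g₂) := ⟨1⟩
  haveI : Nonempty (Subgroup.zpowers g₃) := ⟨1⟩
  haveI : Nonempty (Subgroup.zpowers g₄) := ⟨1⟩
  have eG := 𝒥X.isIsogenous_image_sum_pushforward_act 𝒥G (fun g : Perm (Fin 4) => act g) qG hqG P₀ tG htG
  have e2 := 𝒥X.isIsogenous_image_sum_pushforward_act_symm 𝒥2 (fun h : Subgroup.zpowers g₂ => act h) q2 hq2 P₀ t2 ht2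
  have e3 := 𝒥X.isIsogenous_image_sum_pushforward_act_symm 𝒥3 (fun h : Subgroup.zpowers g₃ => act h) q3 hq3 P₀ t3 ht3
  have e4 := 𝒥X.isIsogenous_image_sum_pushforward_act_symm 𝒥4 (fun h : Subgroup.zpowers g₄ => act h) q4 hq4 P₀ t4 ht4
  exact (((AbelianVariety.IsIsogenous.refl 𝒥X.J).biprod (eG.biprod eG)).trans h).trans (e2.biprod (e3.biprod e4))

/-- **The `S₄` genus relation `g_X + 2 g_{X/S₄} = g_{X/C₂} + g_{X/C₃} + g_{X/C₄}`** on the dimensions of the Jacobians.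
[cite: KaniRosen1989, Thm. B] [cite: KorchmarosLiaTimpanella2021, §10 Thm. 10.1] -/
theorem dim_symFour_quotientJacobian
    {YG : SchemeOver k} (𝒥G : Jacobian YG) (qG : X ⟶ YG)
    (hqG : IsSepQuotient (fun g : Perm (Fin 4) => act g) qG) (tG : 𝒥G.J ⟶ 𝒥X.J)
    (htG : 𝒥X.pushforward 𝒥G qG ≫ tG = ∑ g : Perm (Fin 4), 𝒥X.pushforward 𝒥X (act g).hom)
    {Y2 : SchemeOver k} (𝒥2 : Jacobian Y2) (q2 : X ⟶ Y2)
    (hq2 : IsSepQuotient (fun h : Subgroup.zpowers (swap (0 : Fin 4) 1) => act h) q2) (t2 : 𝒥2.J ⟶ 𝒥X.J)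
    (ht2 : 𝒥X.pushforward 𝒥2 q2 ≫ t2 = ∑ h : Subgroup.zpowers (swap (0 : Fin 4) 1), 𝒥X.pushforward 𝒥X (act h).hom)
    {Y3 : SchemeOver k} (𝒥3 : Jacobian Y3) (q3 : X ⟶ Y3)
    (hq3 : IsSepQuotient (fun h : Subgroup.zpowers (swap (0 : Fin 4) 1 * swap 1 2) => act h) q3) (t3 : 𝒥3.J ⟶ 𝒥X.J)
    (ht3 : 𝒥X.pushforward 𝒥3 q3 ≫ t3 = ∑ h : Subgroup.zpowers (swap (0 : Fin 4) 1 * swap 1 2), 𝒥X.pushforward 𝒥X (act h).hom)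
    {Y4 : SchemeOver k} (𝒥4 : Jacobian Y4) (q4 : X ⟶ Y4)
    (hq4 : IsSepQuotient (fun h : Subgroup.zpowers (swap (0 : Fin 4) 1 * swap 1 2 * swap 2 3) => act h) q4) (t4 : 𝒥4.J ⟶ 𝒥X.J)
    (ht4 : 𝒥X.pushforward 𝒥4 q4 ≫ t4 = ∑ h : Subgroup.zpowers (swap (0 : Fin 4) 1 * swap 1 2 * swap 2 3), 𝒥X.pushforward 𝒥X (act h).hom)
    (P₀ : AlgPoints X k) :
    𝒥X.J.dim + 2 * 𝒥G.J.dim = 𝒥2.J.dim + 𝒥3.J.dim + 𝒥4.J.dim := by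
  have e := (𝒥X.isIsogenous_symFour_quotientJacobian act 𝒥G qG hqG tG htG 𝒥2 q2 hq2 t2 ht2 𝒥3 q3 hq3 t3 ht3 𝒥4 q4 hq4 t4 ht4
    P₀).dim_eq
  simp only [AbelianVariety.dim_biprod] at e
  omega

end SymFour

/-! ## §3 The alternating group `A₅` (icosahedral) -/

section AltFive

variable {k : Type u} [Field k] [PerfectField k] {X : SchemeOver k} (𝒥X : Jacobian X)
  (act : alternatingGroup (Fin 5) →* Aut X)

/-- **`J_X × J_{X/A₅}² ∼ J_{X/⟨(01)(23)⟩} × J_{X/⟨(012)⟩} × J_{X/⟨(01234)⟩}`** for an action of `A₅ = alternatingGroup (Fin 5)` on `X`, quotients by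
`A₅` and by the cyclic subgroups of orders `2`, `3`, `5` generated by `(01)(23)`, `(012)`, `(01234)`, with Jacobians and pinned pull-backs, a rational
point on `X`, perfect ground field — ★ `AbelianVariety.isIsogenous_altFive` transported to the quotient Jacobians.
[cite: KorchmarosLiaTimpanella2021, §10 Thm. 10.1 (32)–(33)] [cite: KaniRosen1989, Thm. B] -/
theorem isIsogenous_altFive_quotientJacobian
    {YG : SchemeOver k} (𝒥G : Jacobian YG) (qG : X ⟶ YG)
    (hqG : IsSepQuotient (fun g : alternatingGroup (Fin 5) => act g) qG) (tG : 𝒥G.J ⟶ 𝒥X.J)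
    (htG : 𝒥X.pushforward 𝒥G qG ≫ tG = ∑ g : alternatingGroup (Fin 5), 𝒥X.pushforward 𝒥X (act g).hom)
    {Y2 : SchemeOver k} (𝒥2 : Jacobian Y2) (q2 : X ⟶ Y2)
    (hq2 : IsSepQuotient (fun h : Subgroup.zpowers (⟨swap (0 : Fin 5) 1 * swap 2 3,
      Perm.mem_alternatingGroup.2 (by decide)⟩ : alternatingGroup (Fin 5)) => act h) q2) (t2 : 𝒥2.J ⟶ 𝒥X.J)
    (ht2 : 𝒥X.pushforward 𝒥2 q2 ≫ t2 = ∑ h : Subgroup.zpowers (⟨swap (0 : Fin 5) 1 * swap 2 3,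
      Perm.mem_alternatingGroup.2 (by decide)⟩ : alternatingGroup (Fin 5)), 𝒥X.pushforward 𝒥X (act h).hom)
    {Y3 : SchemeOver k} (𝒥3 : Jacobian Y3) (q3 : X ⟶ Y3)
    (hq3 : IsSepQuotient (fun h : Subgroup.zpowers (⟨swap (0 : Fin 5) 1 * swap 1 2,
      Perm.mem_alternatingGroup.2 (by decide)⟩ : alternatingGroup (Fin 5)) => act h) q3) (t3 : 𝒥3.J ⟶ 𝒥X.J)
    (ht3 : 𝒥X.pushforward 𝒥3 q3 ≫ t3 = ∑ h : Subgroup.zpowers (⟨swap (0 : Fin 5) 1 * swap 1 2,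
      Perm.mem_alternatingGroup.2 (by decide)⟩ : alternatingGroup (Fin 5)), 𝒥X.pushforward 𝒥X (act h).hom)
    {Y5 : SchemeOver k} (𝒥5 : Jacobian Y5) (q5 : X ⟶ Y5)
    (hq5 : IsSepQuotient (fun h : Subgroup.zpowers (⟨swap (0 : Fin 5) 1 * swap 1 2 * swap 2 3 * swap 3 4,
      Perm.mem_alternatingGroup.2 (by decide)⟩ : alternatingGroup (Fin 5)) => act h) q5) (t5 : 𝒥5.J ⟶ 𝒥X.J)
    (ht5 : 𝒥X.pushforward 𝒥5 q5 ≫ t5 = ∑ h : Subgroup.zpowers (⟨swap (0 : Fin 5) 1 * swap 1 2 * swap 2 3 * swap 3 4,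
      Perm.mem_alternatingGroup.2 (by decide)⟩ : alternatingGroup (Fin 5)), 𝒥X.pushforward 𝒥X (act h).hom)
    (P₀ : AlgPoints X k) :
    AbelianVariety.IsIsogenous (𝒥X.J ⊞ (𝒥G.J ⊞ 𝒥G.J)) (𝒥2.J ⊞ (𝒥3.J ⊞ 𝒥5.J)) := by
  let ρ : alternatingGroup (Fin 5) →* End 𝒥X.J :=
    { toFun := fun g => 𝒥X.pushforward 𝒥X (act g).hom
      map_one' := by
        change 𝒥X.pushforward 𝒥X (act 1).hom = 𝟙 𝒥X.J
        rw [map_one]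
        exact 𝒥X.pushforward_id
      map_mul' := fun g g' => by
        change 𝒥X.pushforward 𝒥X (act (g * g')).hom =
          𝒥X.pushforward 𝒥X (act g').hom ≫ 𝒥X.pushforward 𝒥X (act g).hom
        rw [map_mul, ← pushforward_comp]
        rfl }
  have hρ : ∀ g, ρ g = 𝒥X.pushforward 𝒥X (act g).hom := fun _ => rfl
  have hN₂ := 𝒥X.end_of_sum_subgroup act ρ hρ (Subgroup.zpowers (⟨swap (0 : Fin 5) 1 * swap 2 3,
      Perm.mem_alternatingGroup.2 (by decide)⟩ : alternatingGroup (Fin 5)))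
  have hN₃ := 𝒥X.end_of_sum_subgroup act ρ hρ (Subgroup.zpowers (⟨swap (0 : Fin 5) 1 * swap 1 2,
      Perm.mem_alternatingGroup.2 (by decide)⟩ : alternatingGroup (Fin 5)))
  have hN₅ := 𝒥X.end_of_sum_subgroup act ρ hρ (Subgroup.zpowers (⟨swap (0 : Fin 5) 1 * swap 1 2 * swap 2 3 * swap 3 4,
      Perm.mem_alternatingGroup.2 (by decide)⟩ : alternatingGroup (Fin 5)))
  have hNG := 𝒥X.end_of_sum_univ act ρ hρ
  have h := AbelianVariety.isIsogenous_altFive ρ hN₂ hN₃ hN₅ hNG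
  -- abstract the three generators (no concrete permutation is left for the kernel to evaluate)
  generalize (⟨swap (0 : Fin 5) 1 * swap 1 2 * swap 2 3 * swap 3 4, Perm.mem_alternatingGroup.2 (by decide)⟩ :
    alternatingGroup (Fin 5)) = a₅ at h hq5 ht5
  generalize (⟨swap (0 : Fin 5) 1 * swap 1 2, Perm.mem_alternatingGroup.2 (by decide)⟩ : alternatingGroup (Fin 5)) = a₃
    at h hq3 ht3
  generalize (⟨swap (0 : Fin 5) 1 * swap 2 3, Perm.mem_alternatingGroup.2 (by decide)⟩ : alternatingGroup (Fin 5)) = a₂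
    at h hq2 ht2
  haveI : Nonempty (Subgroup.zpowers a₂) := ⟨1⟩
  haveI : Nonempty (Subgroup.zpowers a₃) := ⟨1⟩
  haveI : Nonempty (Subgroup.zpowers a₅) := ⟨1⟩
  have eG := 𝒥X.isIsogenous_image_sum_pushforward_act 𝒥G (fun g : alternatingGroup (Fin 5) => act g) qG hqG P₀ tG htG
  have e2 := 𝒥X.isIsogenous_image_sum_pushforward_act_symm 𝒥2 (fun h : Subgroup.zpowers a₂ => act h) q2 hq2 P₀ t2 ht2
  have e3 := 𝒥X.isIsogenous_image_sum_pushforward_act_symm 𝒥3 (fun h : Subgroup.zpowers a₃ => act h) q3 hq3 P₀ t3 ht3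
  have e5 := 𝒥X.isIsogenous_image_sum_pushforward_act_symm 𝒥5 (fun h : Subgroup.zpowers a₅ => act h) q5 hq5 P₀ t5 ht5
  exact (((AbelianVariety.IsIsogenous.refl 𝒥X.J).biprod (eG.biprod eG)).trans h).trans (e2.biprod (e3.biprod e5))

/-- **The `A₅` genus relation `g_X + 2 g_{X/A₅} = g_{X/C₂} + g_{X/C₃} + g_{X/C₅}`** on the dimensions of the Jacobians.
[cite: KorchmarosLiaTimpanella2021, §10 Thm. 10.1 (32)] [cite: KaniRosen1989, Thm. B] -/
theorem dim_altFive_quotientJacobian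
    {YG : SchemeOver k} (𝒥G : Jacobian YG) (qG : X ⟶ YG)
    (hqG : IsSepQuotient (fun g : alternatingGroup (Fin 5) => act g) qG) (tG : 𝒥G.J ⟶ 𝒥X.J)
    (htG : 𝒥X.pushforward 𝒥G qG ≫ tG = ∑ g : alternatingGroup (Fin 5), 𝒥X.pushforward 𝒥X (act g).hom)
    {Y2 : SchemeOver k} (𝒥2 : Jacobian Y2) (q2 : X ⟶ Y2)
    (hq2 : IsSepQuotient (fun h : Subgroup.zpowers (⟨swap (0 : Fin 5) 1 * swap 2 3,
      Perm.mem_alternatingGroup.2 (by decide)⟩ : alternatingGroup (Fin 5)) => act h) q2) (t2 : 𝒥2.J ⟶ 𝒥X.J)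
    (ht2 : 𝒥X.pushforward 𝒥2 q2 ≫ t2 = ∑ h : Subgroup.zpowers (⟨swap (0 : Fin 5) 1 * swap 2 3,
      Perm.mem_alternatingGroup.2 (by decide)⟩ : alternatingGroup (Fin 5)), 𝒥X.pushforward 𝒥X (act h).hom)
    {Y3 : SchemeOver k} (𝒥3 : Jacobian Y3) (q3 : X ⟶ Y3)
    (hq3 : IsSepQuotient (fun h : Subgroup.zpowers (⟨swap (0 : Fin 5) 1 * swap 1 2,
      Perm.mem_alternatingGroup.2 (by decide)⟩ : alternatingGroup (Fin 5)) => act h) q3) (t3 : 𝒥3.J ⟶ 𝒥X.J)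
    (ht3 : 𝒥X.pushforward 𝒥3 q3 ≫ t3 = ∑ h : Subgroup.zpowers (⟨swap (0 : Fin 5) 1 * swap 1 2,
      Perm.mem_alternatingGroup.2 (by decide)⟩ : alternatingGroup (Fin 5)), 𝒥X.pushforward 𝒥X (act h).hom)
    {Y5 : SchemeOver k} (𝒥5 : Jacobian Y5) (q5 : X ⟶ Y5)
    (hq5 : IsSepQuotient (fun h : Subgroup.zpowers (⟨swap (0 : Fin 5) 1 * swap 1 2 * swap 2 3 * swap 3 4,
      Perm.mem_alternatingGroup.2 (by decide)⟩ : alternatingGroup (Fin 5)) => act h) q5) (t5 : 𝒥5.J ⟶ 𝒥X.J)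
    (ht5 : 𝒥X.pushforward 𝒥5 q5 ≫ t5 = ∑ h : Subgroup.zpowers (⟨swap (0 : Fin 5) 1 * swap 1 2 * swap 2 3 * swap 3 4,
      Perm.mem_alternatingGroup.2 (by decide)⟩ : alternatingGroup (Fin 5)), 𝒥X.pushforward 𝒥X (act h).hom)
    (P₀ : AlgPoints X k) :
    𝒥X.J.dim + 2 * 𝒥G.J.dim = 𝒥2.J.dim + 𝒥3.J.dim + 𝒥5.J.dim := by
  have e := (𝒥X.isIsogenous_altFive_quotientJacobian act 𝒥G qG hqG tG htG 𝒥2 q2 hq2 t2 ht2 𝒥3 q3 hq3 t3 ht3 𝒥5 q5 hq5 t5 ht5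
    P₀).dim_eq
  simp only [AbelianVariety.dim_biprod] at e
  omega

end AltFive

end Jacobian

end Literature.AlgebraicGeometry.Motives

end
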